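import Literature.NumberTheory.Automorphic.ArchTorusOrbitalContinuity        -- ★ p839464 (V2)-glob FILE B (F0P3a-p06 (g9)): global joint properness, `integral_descConj_archDiagTorus_eq_inv_smul`
import Literature.NumberTheory.Automorphic.ArchTorusOrbitalFunctionCompact    -- ★ p838154 (V2)-Q: per-place unfolding `integral_descConj_circleDiagonal_eq_inv_smul`
import Literature.NumberTheory.Automorphic.ArchTorusWeylAction                -- ★ p838375 (V8)-lite: `exists_conj_circleDiagonal_eq_of_sign` (weighted-monomial Weyl representatives)
import Literature.NumberTheory.Automorphic.ArchStableClassRegularTorus        -- ★ (F0P3a-p02 (g9)): `archPiEquivCM_archDiagTorus`, `im_embedding_diagonal_eq_zero`; via it ★ `isConj_arch_iff_forall_place`, ★ `mem_archLocal_diagonal_iff_mem_unitaryGroupOfForm`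
import HarnessLib

/-!
# The torus orbital function on `G′_∞ = U(diag α)(L⁺ ⊗ ℝ)` is WEYL-INVARIANT, and VANISHES near regular points whose class misses the support
# (ROAD-Sd bricks «(V2)-W» + rider «(V2)-van»; Rogawski 1990 §3.7, §4.1, §8.2–8.3; Bröcker–tom Dieck IV (3.2))

Topic `NumberTheory/Automorphic`; namespace `Literature.NumberTheory.Automorphic.UnitaryGroup`.  THEOREMS ONLY (no `def`, no instance, no notation, no axiom,
no named fact, no `sorry`).  Cell `pub/hodgecm-mathlib`, ENGINE T1 (crux H413 = `stmt-HodgeConjecture-24833`); floor-1 preparation, count-neutral, under books rows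
#111 (S-d) ∕ #88 (ST-∞) (ROAD-Sd §2: the limit formulas (L-cont)∕(L-jump)∕(L-st)∕(L-H) differentiate the torus orbital function `z ↦ Φ(t(z), f)` on
`T_∞ = (S¹)^{W × N}`; the H-side surjectivity and the jump letters read it as a `W`-INVARIANT function with known support); author F0P3a-p06 (g10) (LEAD DESK
WORD T8-6 (4), F0P3a-plan (g9), 2026-09-01), over ★ (V2)-glob `ArchTorusOrbitalContinuity` (p839464), ★ (V8)-lite `ArchTorusWeylAction` (p838375) and ★ F0P3a-p02's
`ArchStableClassRegularTorus` (regular torus classes, place by place).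

CARRIERS (token-exact): `t(z) = archDiagTorus L N α z` (★ D1′b), `z : W → Fin N → S¹`, `W = {w : InfinitePlace L // IsComplex w}`; `α` diagonal hermitian
(`c α_i = α_i`, ★ p02's `hherm`) and non-degenerate (`α_i ≠ 0`); a family of permutations `ρ : W → Perm (Fin N)` is ADMISSIBLE when every `ρ_w` preserves the signs
of the real weights `re σ_w(α_i)` (`hsign`, the `↔` convention of ★ `isConj_circleDiagonal_iff_exists_perm` ∕ ★ `isConj_archDiagTorus_iff_exists`) — `Π_w (S_{p_w} × S_{q_w})`,
the Weyl group of the compact Cartan; the conjugation average `∫_{G′_∞} f(g·t(z)·g⁻¹) dν(g)` and the fixed-quotient torus term `∫ descConj (t z) T_∞ f d(dν∕dt_T)` are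
those of ★ p839464.

WHAT IS PROVED.
* §1 (generic group `G`, right-invariant `ν`, ANY `f`): `integral_comp_conj_conj` — `∫ f(h·(u t u⁻¹)·h⁻¹) dν(h) = ∫ f(h·t·h⁻¹) dν(h)` (Mathlib `integral_mul_right_eq_self`);
  `integral_comp_conj_eq_of_isConj`.
* §2 WEYL REPRESENTATIVES: `exists_conj_circleDiagonal_eq_comp_perm` ∕ `isConj_circleDiagonal_comp_perm` (per place, IN `G_w = archLocal L N (diagonal α) w`, for EVERY `z`,
  singular included: the weighted monomial of ★ `exists_conj_circleDiagonal_eq_of_sign` lies in `G_w` by ★ `mem_archLocal_diagonal_iff_mem_unitaryGroupOfForm`);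
  **`isConj_archDiagTorus_comp_perm`** — `t(z) ∼ t(w ↦ z_w ∘ ρ_w)` in `G′_∞` for admissible `ρ` and EVERY `z` (assembled by ★ `isConj_arch_iff_forall_place` +
  ★ `archPiEquivCM_archDiagTorus`; for regular `z` this is the `⇐` half of ★ p02 `isConj_archDiagTorus_iff_exists`, whose `⇒` half says admissibility is necessary);
  `exists_conj_archDiagTorus_eq_comp_perm`.
* §3 **WEYL INVARIANCE OF THE TORUS ORBITAL FUNCTION**: **`integral_comp_conj_archDiagTorus_comp_perm`** — `∫ f(g·t(z∘ρ)·g⁻¹) dν = ∫ f(g·t(z)·g⁻¹) dν` for EVERY `f`, EVERY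
  `z`, right-invariant `ν`; `integral_descConj_archDiagTorus_comp_perm` (the fixed-quotient `F_f` of ★ p839464, `f` continuous); `orbitalIntegral_archDiagTorus_comp_perm`
  (the regular-point Weil-form orbital integrals with the torus-transported centraliser measures); per-place twins `integral_comp_conj_circleDiagonal_comp_perm`,
  `integral_descConj_circleDiagonal_comp_perm`.
* §4 rider (V2)-van — SUPPORT ON THE REGULAR SET: `isCompact_setOf_mem_and_exists_conj_archDiagTorus_mem` (for compact `K ⊆ T_reg` and compact `C`, the set of `z ∈ K`
  whose class meets `C` is compact — the `z`-projection of the closed pair set inside ★ joint properness × `K`); **`eventually_forall_comp_conj_archDiagTorus_eq_zero`** —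
  if the class of a REGULAR `t(z₀)` misses `tsupport f` (`f` compactly supported) then `g ↦ f(g·t(z)·g⁻¹)` is IDENTICALLY ZERO for all `z` near `z₀`; hence
  `eventually_integral_comp_conj_archDiagTorus_eq_zero`, `eventually_integral_descConj_archDiagTorus_eq_zero` (`F_f` vanishes on a neighbourhood of `z₀`).
NOT HERE: the converse of §2 (★ p02, regular `z`); `C^∞` on `T_reg` ((V2)-smooth, F0P3a-p07); the singular set beyond §4 ((L-jump), (V9)).  HONEST LABEL: HC_CM is
proved only modulo the printed citations until rung 0 closes; this file is bookkeeping on a real group and pays nothing by itself.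

## References
* [Rogawski1990] J. D. Rogawski, *Automorphic Representations of Unitary Groups in Three Variables*, Ann. of Math. Stud. 123 (1990): §3.7 Prop. 3.7.1 pp. 29–30
  (`Ω(T, G)` over `ℝ`), §4.1 (4.1.1) p. 39, §8.2 Prop. 8.2.1 p. 118 and p. 122 (`γ, γ₁, γ₂`; orbital integrals as functions on `T`), §8.3 p. 122, §4.9 p. 54.
* [BrockerTomDieck1985] Th. Bröcker, T. tom Dieck, *Representations of Compact Lie Groups*, GTM 98 (1985), Ch. IV (3.1)–(3.2) (`W(U(n)) = S_n`, monomial matrices).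
* [Shelstad1979] D. Shelstad, *Characters and inner forms of a quasi-split group over ℝ*, Compositio Math. 39 (1979), §4 (orbital integrals on `T_reg` as
  `W`-invariant functions).
* [DeitmarEchterhoff2014] A. Deitmar, S. Echterhoff, *Principles of Harmonic Analysis*, 2nd ed. (2014), Lemma 9.3.3 (properness of conjugation over the regular set).
* [Folland1995] G. B. Folland, *A Course in Abstract Harmonic Analysis* (1995), §2.6 (2.52) (quotient integral formula), (2.28) (right translates).
-/

set_option autoImplicit false

noncomputable section

open MeasureTheory Measure NumberField NumberField.InfinitePlace Filter Topology Matrix Equiv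
open Literature.MeasureTheory.Group
open scoped MatrixGroups ComplexConjugate

namespace Literature.NumberTheory.Automorphic.UnitaryGroup

/-! ## §1 Conjugating the base point does not change a conjugation average against a right-invariant measure -/

section Generic

variable {G : Type*} [Group G] [MeasurableSpace G] [MeasurableMul G] (ν : Measure G) [ν.IsMulRightInvariant]
  {E : Type*} [NormedAddCommGroup E] [NormedSpace ℝ E]

/-- **`∫ f(h·(u t u⁻¹)·h⁻¹) dν(h) = ∫ f(h·t·h⁻¹) dν(h)`** for a right-invariant `ν` and ANY `f` (substitute `h ↦ h u`; Mathlib `integral_mul_right_eq_self`).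
[cite: Folland1995, §2.2 (2.28)] [cite: Rogawski1990, §4.1 p. 39] -/
theorem integral_comp_conj_conj (u t : G) (f : G → E) :
    ∫ h, f (h * (u * t * u⁻¹) * h⁻¹) ∂ν = ∫ h, f (h * t * h⁻¹) ∂ν := by
  have h1 : (fun h : G => f (h * (u * t * u⁻¹) * h⁻¹)) = fun h : G => (fun x : G => f (x * t * x⁻¹)) (h * u) := by
    funext h
    simp only [_root_.mul_inv_rev, mul_assoc]
  rw [h1, integral_mul_right_eq_self (fun x : G => f (x * t * x⁻¹)) u]

/-- Conjugate base points have the same conjugation averages (right-invariant `ν`, any `f`). [cite: Folland1995, §2.2 (2.28)] [cite: Rogawski1990, §4.1 p. 39] -/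
theorem integral_comp_conj_eq_of_isConj {t t' : G} (h : IsConj t t') (f : G → E) :
    ∫ h, f (h * t' * h⁻¹) ∂ν = ∫ h, f (h * t * h⁻¹) ∂ν := by
  obtain ⟨u, rfl⟩ := isConj_iff.mp h
  exact integral_comp_conj_conj ν u t f

end Generic

/-! ## §2 Weyl representatives: `diag(z) ∼ diag(z ∘ ρ)` in `G_w` and `t(z) ∼ t(z ∘ ρ)` in `G′_∞` for sign-preserving `ρ` — EVERY `z` -/

section Place

variable (L : Type) [Field L] (N : ℕ) (α : Fin N → L) (w : {w : InfinitePlace L // IsComplex w})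

/-- **A WEYL REPRESENTATIVE IN `G_w`**: for `ρ` preserving the signs of the real weights `re σ_w(α_i)` (`σ_w(α_i)` real, `α_i ≠ 0`), some `g ∈ G_w = archLocal L N (diagonal α) w`
conjugates `diag(z)` to `diag(z ∘ ρ)` — for EVERY `z` (the weighted monomial `M(ρ⁻¹, √(e_j ∕ e_{ρ⁻¹ j}))` of ★ `exists_conj_circleDiagonal_eq_of_sign`, placed in `G_w` by
★ `mem_archLocal_diagonal_iff_mem_unitaryGroupOfForm`). [cite: BrockerTomDieck1985, Ch. IV (3.2)] [cite: Rogawski1990, §3.7 Prop. 3.7.1 pp. 29–30; §8.2 p. 122] -/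
theorem exists_conj_circleDiagonal_eq_comp_perm (hα : ∀ i, α i ≠ 0) (hreal : ∀ i, (w.1.embedding (α i)).im = 0)
    {ρ : Perm (Fin N)} (hsign : ∀ i, 0 < (w.1.embedding (α (ρ i))).re ↔ 0 < (w.1.embedding (α i)).re) (z : Fin N → Circle) :
    ∃ g : archLocal L N (diagonal α) w,
      g * ⟨circleDiagonal N z, circleDiagonal_mem_archLocal_diagonal L N α w z⟩ * g⁻¹ =
        ⟨circleDiagonal N (z ∘ ρ), circleDiagonal_mem_archLocal_diagonal L N α w (z ∘ ρ)⟩ := by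
  have he := re_embedding_ne_zero L N α w hα hreal
  have hpos : ∀ j, 0 < (w.1.embedding (α j)).re / (w.1.embedding (α (ρ.symm j))).re := fun j =>
    div_pos_of_pos_iff (he j) (he _) (by rw [← hsign (ρ.symm j), Equiv.apply_symm_apply])
  obtain ⟨g, hg⟩ := exists_conj_circleDiagonal_eq_of_sign N hpos z
  refine ⟨⟨(g : GL (Fin N) ℂ), (mem_archLocal_diagonal_iff_mem_unitaryGroupOfForm L N α w hreal _).mpr g.2⟩, Subtype.ext ?_⟩
  simpa only [Subgroup.coe_mul, Subgroup.coe_inv, Equiv.symm_symm, Function.comp_def] using hg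

/-- `diag(z) ∼ diag(z ∘ ρ)` IN `G_w` for sign-preserving `ρ`, every `z`. [cite: BrockerTomDieck1985, Ch. IV (3.2)] [cite: Rogawski1990, §3.7 Prop. 3.7.1 pp. 29–30] -/
theorem isConj_circleDiagonal_comp_perm (hα : ∀ i, α i ≠ 0) (hreal : ∀ i, (w.1.embedding (α i)).im = 0)
    {ρ : Perm (Fin N)} (hsign : ∀ i, 0 < (w.1.embedding (α (ρ i))).re ↔ 0 < (w.1.embedding (α i)).re) (z : Fin N → Circle) :
    IsConj (⟨circleDiagonal N z, circleDiagonal_mem_archLocal_diagonal L N α w z⟩ : archLocal L N (diagonal α) w)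
      ⟨circleDiagonal N (z ∘ ρ), circleDiagonal_mem_archLocal_diagonal L N α w (z ∘ ρ)⟩ :=
  isConj_iff.mpr (exists_conj_circleDiagonal_eq_comp_perm L N α w hα hreal hsign z)

end Place

section Global

variable (L : Type) [Field L] [NumberField L] [IsCMField L] (N : ℕ) (α : Fin N → L)

/-- **`t(z) ∼ t(w ↦ z_w ∘ ρ_w)` IN `G′_∞ = U(diag α)(L⁺ ⊗ ℝ)`** for `α` hermitian non-degenerate and an ADMISSIBLE family `ρ` (each `ρ_w` preserves the signs of
`re σ_w(α_i)`) — for EVERY `z`, singular included (place by place by §2 and ★ `isConj_arch_iff_forall_place`, ★ `archPiEquivCM_archDiagTorus`).  For regular `z` this is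
the `⇐` half of ★ `isConj_archDiagTorus_iff_exists` (F0P3a-p02), whose `⇒` half shows admissibility is also necessary. [cite: Rogawski1990, §3.7 Prop. 3.7.1 pp. 29–30; §8.2 Prop. 8.2.1 p. 118]
[cite: BrockerTomDieck1985, Ch. IV (3.2)] -/
theorem isConj_archDiagTorus_comp_perm (hα : ∀ i, α i ≠ 0) (hherm : ∀ i, (IsCMField.complexConj L (α i) : L) = α i)
    {ρ : {w : InfinitePlace L // IsComplex w} → Perm (Fin N)}
    (hsign : ∀ (w : {w : InfinitePlace L // IsComplex w}) (i : Fin N), 0 < (w.1.embedding (α (ρ w i))).re ↔ 0 < (w.1.embedding (α i)).re)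
    (z : {w : InfinitePlace L // IsComplex w} → Fin N → Circle) :
    IsConj (archDiagTorus L N α z) (archDiagTorus L N α fun w => z w ∘ ρ w) := by
  refine (isConj_arch_iff_forall_place L N (diagonal α) _ _).mpr fun w => ?_
  rw [archPiEquivCM_archDiagTorus, archPiEquivCM_archDiagTorus]
  exact isConj_circleDiagonal_comp_perm L N α w hα (im_embedding_diagonal_eq_zero L N α hherm w) (hsign w) (z w)

/-- **A GLOBAL WEYL REPRESENTATIVE**: some `g ∈ G′_∞` with `g · t(z) · g⁻¹ = t(z ∘ ρ)` (admissible `ρ`, every `z`). [cite: Rogawski1990, §3.7 Prop. 3.7.1 pp. 29–30]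
[cite: BrockerTomDieck1985, Ch. IV (3.2)] -/
theorem exists_conj_archDiagTorus_eq_comp_perm (hα : ∀ i, α i ≠ 0) (hherm : ∀ i, (IsCMField.complexConj L (α i) : L) = α i)
    {ρ : {w : InfinitePlace L // IsComplex w} → Perm (Fin N)}
    (hsign : ∀ (w : {w : InfinitePlace L // IsComplex w}) (i : Fin N), 0 < (w.1.embedding (α (ρ w i))).re ↔ 0 < (w.1.embedding (α i)).re)
    (z : {w : InfinitePlace L // IsComplex w} → Fin N → Circle) :
    ∃ g : arch (↥(maximalRealSubfield L)) L (IsCMField.complexConj L) N (diagonal α),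
      g * archDiagTorus L N α z * g⁻¹ = archDiagTorus L N α fun w => z w ∘ ρ w :=
  isConj_iff.mp (isConj_archDiagTorus_comp_perm L N α hα hherm hsign z)

end Global

/-! ## §3 Weyl invariance of the torus orbital function (global and per place) -/

section GlobalIntegral

variable (L : Type) [Field L] [NumberField L] [IsCMField L] (N : ℕ) (α : Fin N → L)
  [MeasurableSpace (arch (↥(maximalRealSubfield L)) L (IsCMField.complexConj L) N (diagonal α))]
  [BorelSpace (arch (↥(maximalRealSubfield L)) L (IsCMField.complexConj L) N (diagonal α))]
  {E : Type*} [NormedAddCommGroup E] [NormedSpace ℝ E]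

/-- **WEYL INVARIANCE OF THE GLOBAL CONJUGATION AVERAGE**: `∫_{G′_∞} f(g·t(z∘ρ)·g⁻¹) dν(g) = ∫_{G′_∞} f(g·t(z)·g⁻¹) dν(g)` for admissible `ρ`, EVERY `z`, EVERY `f`,
and any right-invariant `ν` (§2 + §1). [cite: Rogawski1990, §4.1 p. 39; §8.2 p. 122] [cite: Shelstad1979, §4] -/
theorem integral_comp_conj_archDiagTorus_comp_perm (hα : ∀ i, α i ≠ 0) (hherm : ∀ i, (IsCMField.complexConj L (α i) : L) = α i)
    {ρ : {w : InfinitePlace L // IsComplex w} → Perm (Fin N)}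
    (hsign : ∀ (w : {w : InfinitePlace L // IsComplex w}) (i : Fin N), 0 < (w.1.embedding (α (ρ w i))).re ↔ 0 < (w.1.embedding (α i)).re)
    (z : {w : InfinitePlace L // IsComplex w} → Fin N → Circle)
    (ν : Measure (arch (↥(maximalRealSubfield L)) L (IsCMField.complexConj L) N (diagonal α))) [ν.IsMulRightInvariant]
    (f : arch (↥(maximalRealSubfield L)) L (IsCMField.complexConj L) N (diagonal α) → E) :
    ∫ g, f (g * archDiagTorus L N α (fun w => z w ∘ ρ w) * g⁻¹) ∂ν = ∫ g, f (g * archDiagTorus L N α z * g⁻¹) ∂ν :=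
  integral_comp_conj_eq_of_isConj ν (isConj_archDiagTorus_comp_perm L N α hα hherm hsign z) f

variable [LocallyCompactSpace (arch (↥(maximalRealSubfield L)) L (IsCMField.complexConj L) N (diagonal α))]
  [SecondCountableTopology (arch (↥(maximalRealSubfield L)) L (IsCMField.complexConj L) N (diagonal α))]
  (ν : Measure (arch (↥(maximalRealSubfield L)) L (IsCMField.complexConj L) N (diagonal α))) [ν.IsHaarMeasure] [ν.IsMulRightInvariant]
  (tT : Measure (archDiagTorus L N α).range) [tT.IsHaarMeasure] [tT.IsInvInvariant]
  [MeasurableSpace (arch (↥(maximalRealSubfield L)) L (IsCMField.complexConj L) N (diagonal α) ⧸ (archDiagTorus L N α).range)]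
  [BorelSpace (arch (↥(maximalRealSubfield L)) L (IsCMField.complexConj L) N (diagonal α) ⧸ (archDiagTorus L N α).range)]

/-- **WEYL INVARIANCE OF THE GLOBAL FIXED-QUOTIENT TORUS TERM `F_f(z) = ∫ descConj (t z) T_∞ f d(dν∕dt_T)`** (★ p839464's function; `f` continuous, `ν` Haar
right-invariant): `F_f(z ∘ ρ) = F_f(z)` for admissible `ρ`, every `z` (unfold both sides by ★ `integral_descConj_archDiagTorus_eq_inv_smul`). [cite: Rogawski1990, §8.2 p. 122; §1.7 p. 6]
[cite: Shelstad1979, §4] -/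
theorem integral_descConj_archDiagTorus_comp_perm (hα : ∀ i, α i ≠ 0) (hherm : ∀ i, (IsCMField.complexConj L (α i) : L) = α i)
    {ρ : {w : InfinitePlace L // IsComplex w} → Perm (Fin N)}
    (hsign : ∀ (w : {w : InfinitePlace L // IsComplex w}) (i : Fin N), 0 < (w.1.embedding (α (ρ w i))).re ↔ 0 < (w.1.embedding (α i)).re)
    (z : {w : InfinitePlace L // IsComplex w} → Fin N → Circle)
    (f : arch (↥(maximalRealSubfield L)) L (IsCMField.complexConj L) N (diagonal α) → E) (hf : Continuous f) :
    ∫ y, descConj (archDiagTorus L N α fun w => z w ∘ ρ w) (archDiagTorus L N α).range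
        (range_archDiagTorus_comm_apply L N α fun w => z w ∘ ρ w) f y ∂(quotientMeasure _ tT (isClosed_coe_range_archDiagTorus L N α) ν) =
      ∫ y, descConj (archDiagTorus L N α z) (archDiagTorus L N α).range (range_archDiagTorus_comm_apply L N α z) f y
        ∂(quotientMeasure _ tT (isClosed_coe_range_archDiagTorus L N α) ν) := by
  rw [integral_descConj_archDiagTorus_eq_inv_smul L N α ν tT _ f hf, integral_descConj_archDiagTorus_eq_inv_smul L N α ν tT z f hf,
    integral_comp_conj_archDiagTorus_comp_perm L N α hα hherm hsign z ν f]

/-- **WEYL INVARIANCE OF THE REGULAR-POINT WEIL-FORM ORBITAL INTEGRALS** with the torus-transported centraliser measures `ρ_z = t_T ∘ (Z(t z) = T_∞)⁻¹`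
(★ `orbitalIntegral_archDiagTorus_eq_inv_smul` on both sides): `O_{t(z∘ρ)}(f) = O_{t(z)}(f)` for regular `z`, admissible `ρ`, continuous `f`. [cite: Rogawski1990, §4.1 p. 39; §8.2 p. 122]
[cite: Shelstad1979, §4] -/
theorem orbitalIntegral_archDiagTorus_comp_perm (hα : ∀ i, α i ≠ 0) (hherm : ∀ i, (IsCMField.complexConj L (α i) : L) = α i)
    {ρ : {w : InfinitePlace L // IsComplex w} → Perm (Fin N)}
    (hsign : ∀ (w : {w : InfinitePlace L // IsComplex w}) (i : Fin N), 0 < (w.1.embedding (α (ρ w i))).re ↔ 0 < (w.1.embedding (α i)).re)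
    {z : {w : InfinitePlace L // IsComplex w} → Fin N → Circle} (hz : ∀ w, Function.Injective (z w))
    (ρz : Measure (Subgroup.centralizer ({archDiagTorus L N α z} : Set (arch (↥(maximalRealSubfield L)) L (IsCMField.complexConj L) N (diagonal α)))))
    [ρz.IsHaarMeasure] [ρz.IsInvInvariant]
    (hρz : ρz = tT.map (MulEquiv.subgroupCongr (centralizer_archDiagTorus_eq_range L N α hα hz).symm))
    (ρz' : Measure (Subgroup.centralizer ({archDiagTorus L N α fun w => z w ∘ ρ w} :
      Set (arch (↥(maximalRealSubfield L)) L (IsCMField.complexConj L) N (diagonal α)))))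
    [ρz'.IsHaarMeasure] [ρz'.IsInvInvariant]
    (hρz' : ρz' = tT.map (MulEquiv.subgroupCongr
      (centralizer_archDiagTorus_eq_range L N α hα (z := fun w => z w ∘ ρ w) fun w => (hz w).comp (ρ w).injective).symm))
    [MeasurableSpace (arch (↥(maximalRealSubfield L)) L (IsCMField.complexConj L) N (diagonal α) ⧸
      Subgroup.centralizer ({archDiagTorus L N α z} : Set (arch (↥(maximalRealSubfield L)) L (IsCMField.complexConj L) N (diagonal α))))]
    [BorelSpace (arch (↥(maximalRealSubfield L)) L (IsCMField.complexConj L) N (diagonal α) ⧸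
      Subgroup.centralizer ({archDiagTorus L N α z} : Set (arch (↥(maximalRealSubfield L)) L (IsCMField.complexConj L) N (diagonal α))))]
    [MeasurableSpace (arch (↥(maximalRealSubfield L)) L (IsCMField.complexConj L) N (diagonal α) ⧸
      Subgroup.centralizer ({archDiagTorus L N α fun w => z w ∘ ρ w} :
        Set (arch (↥(maximalRealSubfield L)) L (IsCMField.complexConj L) N (diagonal α))))]
    [BorelSpace (arch (↥(maximalRealSubfield L)) L (IsCMField.complexConj L) N (diagonal α) ⧸
      Subgroup.centralizer ({archDiagTorus L N α fun w => z w ∘ ρ w} :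
        Set (arch (↥(maximalRealSubfield L)) L (IsCMField.complexConj L) N (diagonal α))))]
    (f : arch (↥(maximalRealSubfield L)) L (IsCMField.complexConj L) N (diagonal α) → E) (hf : Continuous f) :
    orbitalIntegral (archDiagTorus L N α fun w => z w ∘ ρ w) f (quotientMeasure _ ρz' (isClosed_coe_centralizer_singleton _) ν) =
      orbitalIntegral (archDiagTorus L N α z) f (quotientMeasure _ ρz (isClosed_coe_centralizer_singleton _) ν) := by
  rw [orbitalIntegral_archDiagTorus_eq_inv_smul L N α ν tT hα (fun w => (hz w).comp (ρ w).injective) ρz' hρz' f hf,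
    orbitalIntegral_archDiagTorus_eq_inv_smul L N α ν tT hα hz ρz hρz f hf, integral_comp_conj_archDiagTorus_comp_perm L N α hα hherm hsign z ν f]

end GlobalIntegral

section PlaceIntegral

variable (L : Type) [Field L] (N : ℕ) (α : Fin N → L) (w : {w : InfinitePlace L // IsComplex w})
  [MeasurableSpace (archLocal L N (diagonal α) w)] [BorelSpace (archLocal L N (diagonal α) w)]
  {E : Type*} [NormedAddCommGroup E] [NormedSpace ℝ E]

/-- **WEYL INVARIANCE OF THE CONJUGATION AVERAGE AT ONE PLACE**: `∫_{G_w} f(g·diag(z∘ρ)·g⁻¹) dν = ∫_{G_w} f(g·diag z·g⁻¹) dν` (sign-preserving `ρ`, every `z`,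
every `f`, right-invariant `ν`). [cite: Rogawski1990, §8.2 p. 122] [cite: Shelstad1979, §4] -/
theorem integral_comp_conj_circleDiagonal_comp_perm (hα : ∀ i, α i ≠ 0) (hreal : ∀ i, (w.1.embedding (α i)).im = 0)
    {ρ : Perm (Fin N)} (hsign : ∀ i, 0 < (w.1.embedding (α (ρ i))).re ↔ 0 < (w.1.embedding (α i)).re) (z : Fin N → Circle)
    (ν : Measure (archLocal L N (diagonal α) w)) [ν.IsMulRightInvariant] (f : archLocal L N (diagonal α) w → E) :
    ∫ g, f (g * ⟨circleDiagonal N (z ∘ ρ), circleDiagonal_mem_archLocal_diagonal L N α w (z ∘ ρ)⟩ * g⁻¹) ∂ν =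
      ∫ g, f (g * ⟨circleDiagonal N z, circleDiagonal_mem_archLocal_diagonal L N α w z⟩ * g⁻¹) ∂ν :=
  integral_comp_conj_eq_of_isConj ν (isConj_circleDiagonal_comp_perm L N α w hα hreal hsign z) f

variable [LocallyCompactSpace (archLocal L N (diagonal α) w)] [SecondCountableTopology (archLocal L N (diagonal α) w)]
  (ν : Measure (archLocal L N (diagonal α) w)) [ν.IsHaarMeasure] [ν.IsMulRightInvariant]
  (tT : Measure ((circleDiagonal N).range.subgroupOf (archLocal L N (diagonal α) w))) [tT.IsHaarMeasure] [tT.IsInvInvariant]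
  [MeasurableSpace (archLocal L N (diagonal α) w ⧸ (circleDiagonal N).range.subgroupOf (archLocal L N (diagonal α) w))]
  [BorelSpace (archLocal L N (diagonal α) w ⧸ (circleDiagonal N).range.subgroupOf (archLocal L N (diagonal α) w))]

/-- **WEYL INVARIANCE OF THE FIXED-QUOTIENT TORUS TERM AT ONE PLACE** (★ (V2)-Q `integral_descConj_circleDiagonal_eq_inv_smul` on both sides; `f` continuous).
[cite: Rogawski1990, §8.2 p. 122; §1.7 p. 6] [cite: Shelstad1979, §4] -/
theorem integral_descConj_circleDiagonal_comp_perm (hα : ∀ i, α i ≠ 0) (hreal : ∀ i, (w.1.embedding (α i)).im = 0)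
    {ρ : Perm (Fin N)} (hsign : ∀ i, 0 < (w.1.embedding (α (ρ i))).re ↔ 0 < (w.1.embedding (α i)).re) (z : Fin N → Circle)
    (f : archLocal L N (diagonal α) w → E) (hf : Continuous f) :
    ∫ y, descConj (⟨circleDiagonal N (z ∘ ρ), circleDiagonal_mem_archLocal_diagonal L N α w (z ∘ ρ)⟩ : archLocal L N (diagonal α) w)
        ((circleDiagonal N).range.subgroupOf (archLocal L N (diagonal α) w)) (circleTorus_comm_circleDiagonal L N α w (z ∘ ρ)) f y
        ∂(quotientMeasure _ tT (isClosed_circleTorus L N α w) ν) =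
      ∫ y, descConj (⟨circleDiagonal N z, circleDiagonal_mem_archLocal_diagonal L N α w z⟩ : archLocal L N (diagonal α) w)
        ((circleDiagonal N).range.subgroupOf (archLocal L N (diagonal α) w)) (circleTorus_comm_circleDiagonal L N α w z) f y
        ∂(quotientMeasure _ tT (isClosed_circleTorus L N α w) ν) := by
  rw [integral_descConj_circleDiagonal_eq_inv_smul L N α w ν tT _ f hf, integral_descConj_circleDiagonal_eq_inv_smul L N α w ν tT z f hf,
    integral_comp_conj_circleDiagonal_comp_perm L N α w hα hreal hsign z ν f]

end PlaceIntegral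

/-! ## §4 Rider (V2)-van: on the regular set the torus orbital function vanishes near every point whose class misses the support -/

section Vanishing

variable (L : Type) [Field L] [NumberField L] [IsCMField L] (N : ℕ) (α : Fin N → L)

/-- **THE `z`-PROJECTION OF THE PAIR SET IS COMPACT**: for compact `K ⊆ T_reg` and compact `C ⊆ G′_∞`, the set of `z ∈ K` whose class `{g·t(z)·g⁻¹}` meets `C` is
compact (the closed pair set `{(g, z) | z ∈ K, g·t(z)·g⁻¹ ∈ C}` lies in ★ `isCompact_setOf_exists_conj_archDiagTorus_mem` `× K`; project to `z`). [cite: Rogawski1990, §8.3 p. 122]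
[cite: DeitmarEchterhoff2014, Lemma 9.3.3] -/
theorem isCompact_setOf_mem_and_exists_conj_archDiagTorus_mem (hα : ∀ i, α i ≠ 0)
    {K : Set ({w : InfinitePlace L // IsComplex w} → Fin N → Circle)} (hK : IsCompact K) (hKreg : K ⊆ {z | ∀ w, Function.Injective (z w)})
    {C : Set (arch (↥(maximalRealSubfield L)) L (IsCMField.complexConj L) N (diagonal α))} (hC : IsCompact C) :
    IsCompact {z : {w : InfinitePlace L // IsComplex w} → Fin N → Circle | z ∈ K ∧
      ∃ g : arch (↥(maximalRealSubfield L)) L (IsCMField.complexConj L) N (diagonal α), g * archDiagTorus L N α z * g⁻¹ ∈ C} := by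
  have hS := isCompact_setOf_exists_conj_archDiagTorus_mem L N α hα hK hKreg hC
  obtain ⟨M, hM⟩ : ∃ M : Set (arch (↥(maximalRealSubfield L)) L (IsCMField.complexConj L) N (diagonal α) ×
      ({w : InfinitePlace L // IsComplex w} → Fin N → Circle)), M = {p | p.2 ∈ K ∧ p.1 * archDiagTorus L N α p.2 * p.1⁻¹ ∈ C} := ⟨_, rfl⟩
  have hconj : Continuous fun p : arch (↥(maximalRealSubfield L)) L (IsCMField.complexConj L) N (diagonal α) ×
      ({w : InfinitePlace L // IsComplex w} → Fin N → Circle) => p.1 * archDiagTorus L N α p.2 * p.1⁻¹ :=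
    (continuous_fst.mul ((continuous_archDiagTorus L N α).comp continuous_snd)).mul continuous_fst.inv
  have hMclosed : IsClosed M := by
    rw [hM]; exact (hK.isClosed.preimage continuous_snd).inter (hC.isClosed.preimage hconj)
  have hMsub : M ⊆ {g : arch (↥(maximalRealSubfield L)) L (IsCMField.complexConj L) N (diagonal α) | ∃ z ∈ K,
      g * archDiagTorus L N α z * g⁻¹ ∈ C} ×ˢ K := by
    rw [hM]; rintro ⟨g, z⟩ ⟨hzK, hgC⟩; exact ⟨⟨z, hzK, hgC⟩, hzK⟩
  have hMc : IsCompact M := (hS.prod hK).of_isClosed_subset hMclosed hMsub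
  have hT : {z : {w : InfinitePlace L // IsComplex w} → Fin N → Circle | z ∈ K ∧
      ∃ g : arch (↥(maximalRealSubfield L)) L (IsCMField.complexConj L) N (diagonal α), g * archDiagTorus L N α z * g⁻¹ ∈ C} = Prod.snd '' M := by
    rw [hM]
    ext z
    simp only [Set.mem_setOf_eq, Set.mem_image, Prod.exists, exists_eq_right]
    constructor
    · rintro ⟨hzK, g, hg⟩; exact ⟨g, hzK, hg⟩
    · rintro ⟨g, hzK, hg⟩; exact ⟨hzK, g, hg⟩
  rw [hT]
  exact hMc.image continuous_snd

/-- **VANISHING NEAR A REGULAR POINT WHOSE CLASS MISSES THE SUPPORT**: if `z₀` is regular and no conjugate `g·t(z₀)·g⁻¹` lies in `tsupport f` (`f` compactly supported),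
then for all `z` in a neighbourhood of `z₀` the integrand `g ↦ f(g·t(z)·g⁻¹)` is IDENTICALLY ZERO on `G′_∞` (the compact projection of the previous theorem with
`C = tsupport f` is closed and misses `z₀`). [cite: Rogawski1990, §8.3 p. 122] [cite: DeitmarEchterhoff2014, Lemma 9.3.3] -/
theorem eventually_forall_comp_conj_archDiagTorus_eq_zero (hα : ∀ i, α i ≠ 0)
    {z₀ : {w : InfinitePlace L // IsComplex w} → Fin N → Circle} (hz₀ : ∀ w, Function.Injective (z₀ w)) {E : Type*} [Zero E]
    (f : arch (↥(maximalRealSubfield L)) L (IsCMField.complexConj L) N (diagonal α) → E) (hfc : HasCompactSupport f)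
    (hmiss : ∀ g : arch (↥(maximalRealSubfield L)) L (IsCMField.complexConj L) N (diagonal α), g * archDiagTorus L N α z₀ * g⁻¹ ∉ tsupport f) :
    ∀ᶠ z in 𝓝 z₀, ∀ g : arch (↥(maximalRealSubfield L)) L (IsCMField.complexConj L) N (diagonal α), f (g * archDiagTorus L N α z * g⁻¹) = 0 := by
  obtain ⟨K, hKnhds, hKsub, hK⟩ := local_compact_nhds (Literature.Topology.isOpen_setOf_forall_injective.mem_nhds hz₀)
  have hP := isCompact_setOf_mem_and_exists_conj_archDiagTorus_mem L N α hα hK hKsub hfc.isCompact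
  have hz₀P : z₀ ∉ {z : {w : InfinitePlace L // IsComplex w} → Fin N → Circle | z ∈ K ∧
      ∃ g : arch (↥(maximalRealSubfield L)) L (IsCMField.complexConj L) N (diagonal α), g * archDiagTorus L N α z * g⁻¹ ∈ tsupport f} := by
    rintro ⟨-, g, hg⟩; exact hmiss g hg
  filter_upwards [hKnhds, hP.isClosed.compl_mem_nhds hz₀P] with z hzK hzP g
  by_contra hne
  exact hzP ⟨hzK, g, subset_tsupport _ (Function.mem_support.mpr hne)⟩

variable [MeasurableSpace (arch (↥(maximalRealSubfield L)) L (IsCMField.complexConj L) N (diagonal α))]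
  {E : Type*} [NormedAddCommGroup E] [NormedSpace ℝ E]

/-- Hence **the conjugation average `z ↦ ∫ f(g·t(z)·g⁻¹) dν` VANISHES ON A NEIGHBOURHOOD of such a `z₀`** (any measure `ν`). [cite: Rogawski1990, §8.3 p. 122]
[cite: DeitmarEchterhoff2014, Lemma 9.3.3] -/
theorem eventually_integral_comp_conj_archDiagTorus_eq_zero (hα : ∀ i, α i ≠ 0)
    {z₀ : {w : InfinitePlace L // IsComplex w} → Fin N → Circle} (hz₀ : ∀ w, Function.Injective (z₀ w))
    (f : arch (↥(maximalRealSubfield L)) L (IsCMField.complexConj L) N (diagonal α) → E) (hfc : HasCompactSupport f)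
    (hmiss : ∀ g : arch (↥(maximalRealSubfield L)) L (IsCMField.complexConj L) N (diagonal α), g * archDiagTorus L N α z₀ * g⁻¹ ∉ tsupport f)
    (ν : Measure (arch (↥(maximalRealSubfield L)) L (IsCMField.complexConj L) N (diagonal α))) :
    ∀ᶠ z in 𝓝 z₀, ∫ g, f (g * archDiagTorus L N α z * g⁻¹) ∂ν = 0 := by
  filter_upwards [eventually_forall_comp_conj_archDiagTorus_eq_zero L N α hα hz₀ f hfc hmiss] with z hz
  simp only [hz, integral_zero]

variable [BorelSpace (arch (↥(maximalRealSubfield L)) L (IsCMField.complexConj L) N (diagonal α))]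
  [LocallyCompactSpace (arch (↥(maximalRealSubfield L)) L (IsCMField.complexConj L) N (diagonal α))]
  [SecondCountableTopology (arch (↥(maximalRealSubfield L)) L (IsCMField.complexConj L) N (diagonal α))]
  (ν : Measure (arch (↥(maximalRealSubfield L)) L (IsCMField.complexConj L) N (diagonal α))) [ν.IsHaarMeasure] [ν.IsMulRightInvariant]
  (tT : Measure (archDiagTorus L N α).range) [tT.IsHaarMeasure] [tT.IsInvInvariant]
  [MeasurableSpace (arch (↥(maximalRealSubfield L)) L (IsCMField.complexConj L) N (diagonal α) ⧸ (archDiagTorus L N α).range)]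
  [BorelSpace (arch (↥(maximalRealSubfield L)) L (IsCMField.complexConj L) N (diagonal α) ⧸ (archDiagTorus L N α).range)]

/-- And **the fixed-quotient torus term `F_f` (★ p839464) VANISHES ON A NEIGHBOURHOOD of such a `z₀`** (`f` continuous with compact support).
[cite: Rogawski1990, §8.3 p. 122; §1.7 p. 6] [cite: DeitmarEchterhoff2014, Lemma 9.3.3] -/
theorem eventually_integral_descConj_archDiagTorus_eq_zero (hα : ∀ i, α i ≠ 0)
    {z₀ : {w : InfinitePlace L // IsComplex w} → Fin N → Circle} (hz₀ : ∀ w, Function.Injective (z₀ w))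
    (f : arch (↥(maximalRealSubfield L)) L (IsCMField.complexConj L) N (diagonal α) → E) (hf : Continuous f) (hfc : HasCompactSupport f)
    (hmiss : ∀ g : arch (↥(maximalRealSubfield L)) L (IsCMField.complexConj L) N (diagonal α), g * archDiagTorus L N α z₀ * g⁻¹ ∉ tsupport f) :
    ∀ᶠ z in 𝓝 z₀, ∫ y, descConj (archDiagTorus L N α z) (archDiagTorus L N α).range (range_archDiagTorus_comm_apply L N α z) f y
        ∂(quotientMeasure _ tT (isClosed_coe_range_archDiagTorus L N α) ν) = 0 := by
  filter_upwards [eventually_integral_comp_conj_archDiagTorus_eq_zero L N α hα hz₀ f hfc hmiss ν] with z hz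
  rw [integral_descConj_archDiagTorus_eq_inv_smul L N α ν tT z f hf, hz, smul_zero]

end Vanishing

end Literature.NumberTheory.Automorphic.UnitaryGroup

end
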